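import Summits.BirchSwinnertonDyer.BirchSwinnertonDyer.Theorems.Rank2ObservatoryRank3WitnessT3
import HarnessLib

/-!
# BirchSwinnertonDyer — rank ≥ 2 observatory: integer tangent certificate and the halves-of-`T` test

HONEST FRAMING: per-curve certified theorems and census instruments; no claim on BSD in rank ≥ 2.

Two decidable certificates for the `ℤ/4`-torsion variant of the rank-3 kernel certificate
(`Rank2ObservatoryRank3WitnessT4`): the integer TANGENT certificate `intTangent` (`(X₃, Y₃) = 2(X₁, Y₁)`
over `ℚ`, denominators cleared; soundness `some_add_self_of_intTangent`) and the HALVES-OF-`T` test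
`halfTOnlyB` mod `q` (the affine points whose double has abscissa `x_T` are `(x₄, ±y₄)`; with
`twoTorsionOnlyB` this pins `Ẽ(𝔽_q)[4] = {O, T̃, ±T̃₄}`: `eq_of_halfTOnlyB`). Sorry-free.
References: Silverman AEC (2009) III.2.3.
-/

-- single-conjunct summit: `Summit.BirchSwinnertonDyer.BirchSwinnertonDyer.…` repeats the name by design
set_option linter.dupNamespace false

namespace Summit.BirchSwinnertonDyer.BirchSwinnertonDyer.Rank2Observatory

open WeierstrassCurve Literature.NumberTheory.EllipticCurves

section Tangent

variable (V : WeierstrassCurve ℤ)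

/-- Integer TANGENT CERTIFICATE, denominators cleared (a Boolean for `decide`):
`(X₃, Y₃) = 2 • (X₁, Y₁)` on `V` with `D = 2Y₁ + a₁X₁ + a₃ ≠ 0`, `n = 3X₁² + 2a₂X₁ + a₄ − a₁Y₁`,
slope `n/D`: `X₃·D² = n² + a₁·n·D − (a₂ + 2X₁)·D²` and `Y₃·D = −(n·(X₃ − X₁) + Y₁·D) − a₁X₃D − a₃D`
(the duplication formula, Silverman AEC III.2.3). [cite: SilvermanAEC2009, III.2.3] -/
def intTangent (V : WeierstrassCurve ℤ) (X₁ Y₁ X₃ Y₃ : ℤ) : Bool :=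
  decide (2 * Y₁ + V.a₁ * X₁ + V.a₃ ≠ 0 ∧
    X₃ * (2 * Y₁ + V.a₁ * X₁ + V.a₃) ^ 2 =
      (3 * X₁ ^ 2 + 2 * V.a₂ * X₁ + V.a₄ - V.a₁ * Y₁) ^ 2
        + V.a₁ * (3 * X₁ ^ 2 + 2 * V.a₂ * X₁ + V.a₄ - V.a₁ * Y₁) * (2 * Y₁ + V.a₁ * X₁ + V.a₃)
        - (V.a₂ + 2 * X₁) * (2 * Y₁ + V.a₁ * X₁ + V.a₃) ^ 2 ∧
    Y₃ * (2 * Y₁ + V.a₁ * X₁ + V.a₃) =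
      -((3 * X₁ ^ 2 + 2 * V.a₂ * X₁ + V.a₄ - V.a₁ * Y₁) * (X₃ - X₁)
          + Y₁ * (2 * Y₁ + V.a₁ * X₁ + V.a₃))
        - V.a₁ * X₃ * (2 * Y₁ + V.a₁ * X₁ + V.a₃) - V.a₃ * (2 * Y₁ + V.a₁ * X₁ + V.a₃))

open scoped Classical in
/-- **Soundness of the tangent certificate** over `ℚ`: `(X₁, Y₁) + (X₁, Y₁) = (X₃, Y₃)` (Mathlib's
`add_self_of_Y_ne`, `slope_of_Y_ne`, clearing `D ≠ 0`). [cite: SilvermanAEC2009, III.2.3] -/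
theorem some_add_self_of_intTangent (hΔ : V.Δ ≠ 0) {X₁ Y₁ X₃ Y₃ : ℤ}
    (h₁ : Y₁ ^ 2 + V.a₁ * X₁ * Y₁ + V.a₃ * Y₁ = X₁ ^ 3 + V.a₂ * X₁ ^ 2 + V.a₄ * X₁ + V.a₆)
    (h₃ : Y₃ ^ 2 + V.a₁ * X₃ * Y₃ + V.a₃ * Y₃ = X₃ ^ 3 + V.a₂ * X₃ ^ 2 + V.a₄ * X₃ + V.a₆)
    (hc : intTangent V X₁ Y₁ X₃ Y₃ = true) :
    haveI := isElliptic_rat V hΔ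
    (Affine.Point.some _ _ (nonsingular_rat_of_eq V hΔ h₁) :
        (V.map (Int.castRingHom ℚ)).toAffine.Point) + .some _ _ (nonsingular_rat_of_eq V hΔ h₁) =
      .some _ _ (nonsingular_rat_of_eq V hΔ h₃) := by
  classical
  simp only [intTangent, decide_eq_true_eq] at hc
  obtain ⟨hD, hX, hY⟩ := hc
  have ha₁ : (V.map (Int.castRingHom ℚ)).a₁ = (V.a₁ : ℚ) := by simp [WeierstrassCurve.map]
  have ha₂ : (V.map (Int.castRingHom ℚ)).a₂ = (V.a₂ : ℚ) := by simp [WeierstrassCurve.map]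
  have ha₃ : (V.map (Int.castRingHom ℚ)).a₃ = (V.a₃ : ℚ) := by simp [WeierstrassCurve.map]
  have ha₄ : (V.map (Int.castRingHom ℚ)).a₄ = (V.a₄ : ℚ) := by simp [WeierstrassCurve.map]
  have hDq : (2 : ℚ) * Y₁ + (V.a₁ : ℚ) * X₁ + (V.a₃ : ℚ) ≠ 0 := by exact_mod_cast hD
  have hXq : (X₃ : ℚ) * ((2 : ℚ) * Y₁ + (V.a₁ : ℚ) * X₁ + (V.a₃ : ℚ)) ^ 2 =
      ((3 : ℚ) * (X₁ : ℚ) ^ 2 + 2 * (V.a₂ : ℚ) * X₁ + (V.a₄ : ℚ) - (V.a₁ : ℚ) * Y₁) ^ 2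
        + (V.a₁ : ℚ) * ((3 : ℚ) * (X₁ : ℚ) ^ 2 + 2 * (V.a₂ : ℚ) * X₁ + (V.a₄ : ℚ) - (V.a₁ : ℚ) * Y₁)
          * ((2 : ℚ) * Y₁ + (V.a₁ : ℚ) * X₁ + (V.a₃ : ℚ))
        - ((V.a₂ : ℚ) + 2 * X₁) * ((2 : ℚ) * Y₁ + (V.a₁ : ℚ) * X₁ + (V.a₃ : ℚ)) ^ 2 := by
    exact_mod_cast hX
  have hYq : (Y₃ : ℚ) * ((2 : ℚ) * Y₁ + (V.a₁ : ℚ) * X₁ + (V.a₃ : ℚ)) =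
      -(((3 : ℚ) * (X₁ : ℚ) ^ 2 + 2 * (V.a₂ : ℚ) * X₁ + (V.a₄ : ℚ) - (V.a₁ : ℚ) * Y₁) * ((X₃ : ℚ) - X₁)
          + (Y₁ : ℚ) * ((2 : ℚ) * Y₁ + (V.a₁ : ℚ) * X₁ + (V.a₃ : ℚ)))
        - (V.a₁ : ℚ) * X₃ * ((2 : ℚ) * Y₁ + (V.a₁ : ℚ) * X₁ + (V.a₃ : ℚ))
        - (V.a₃ : ℚ) * ((2 : ℚ) * Y₁ + (V.a₁ : ℚ) * X₁ + (V.a₃ : ℚ)) := by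
    exact_mod_cast hY
  have hDval : (Y₁ : ℚ) - (V.map (Int.castRingHom ℚ)).toAffine.negY (X₁ : ℚ) (Y₁ : ℚ) =
      2 * Y₁ + (V.a₁ : ℚ) * X₁ + (V.a₃ : ℚ) := by
    simp only [Affine.negY, ha₁, ha₃]; ring
  have hy : (Y₁ : ℚ) ≠ (V.map (Int.castRingHom ℚ)).toAffine.negY (X₁ : ℚ) (Y₁ : ℚ) := by
    intro h; apply hDq; rw [← hDval]; exact sub_eq_zero.mpr h
  rw [Affine.Point.add_self_of_Y_ne hy, Affine.Point.some.injEq]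
  set L := (V.map (Int.castRingHom ℚ)).toAffine.slope (X₁ : ℚ) X₁ Y₁ Y₁ with hLdef
  have hLD : L * ((2 : ℚ) * Y₁ + (V.a₁ : ℚ) * X₁ + (V.a₃ : ℚ)) =
      (3 : ℚ) * (X₁ : ℚ) ^ 2 + 2 * (V.a₂ : ℚ) * X₁ + (V.a₄ : ℚ) - (V.a₁ : ℚ) * Y₁ := by
    rw [hLdef, Affine.slope_of_Y_ne rfl hy, hDval, ha₁, ha₂, ha₄]; exact div_mul_cancel₀ _ hDq
  have hX3 : (V.map (Int.castRingHom ℚ)).toAffine.addX (X₁ : ℚ) X₁ L = X₃ := by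
    apply mul_right_cancel₀ (pow_ne_zero 2 hDq)
    rw [hXq, ← hLD]
    simp only [Affine.addX, ha₁, ha₂]
    ring
  refine ⟨hX3, ?_⟩
  simp only [Affine.addY, Affine.negAddY, Affine.negY, hX3, ha₁, ha₃]
  apply mul_right_cancel₀ hDq
  rw [hYq, ← hLD]
  ring

end Tangent

section HalfT

variable (V : WeierstrassCurve ℤ)

/-- HALVES-OF-`T` TEST (a Boolean for `decide`): every affine point `(β, γ)` of `Ẽ(𝔽_q)` with
non-vertical tangent whose double has abscissa `x_T` (the duplication formula cleared of `D²`) is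
`(x₄, ±y₄)`. [cite: SilvermanAEC2009, III.2.3] -/
def halfTOnlyB (V : WeierstrassCurve ℤ) (q : ℕ) [NeZero q] (xT x₄ y₄ : ℤ) : Bool :=
  decide (∀ β γ : ZMod q,
    γ ^ 2 + (V.a₁ : ZMod q) * β * γ + (V.a₃ : ZMod q) * γ =
      β ^ 3 + (V.a₂ : ZMod q) * β ^ 2 + (V.a₄ : ZMod q) * β + (V.a₆ : ZMod q) →
    2 * γ + (V.a₁ : ZMod q) * β + (V.a₃ : ZMod q) ≠ 0 →
    (xT : ZMod q) * (2 * γ + (V.a₁ : ZMod q) * β + (V.a₃ : ZMod q)) ^ 2 =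
      (3 * β ^ 2 + 2 * (V.a₂ : ZMod q) * β + (V.a₄ : ZMod q) - (V.a₁ : ZMod q) * γ) ^ 2
        + (V.a₁ : ZMod q) * (3 * β ^ 2 + 2 * (V.a₂ : ZMod q) * β + (V.a₄ : ZMod q)
            - (V.a₁ : ZMod q) * γ) * (2 * γ + (V.a₁ : ZMod q) * β + (V.a₃ : ZMod q))
        - ((V.a₂ : ZMod q) + 2 * β) * (2 * γ + (V.a₁ : ZMod q) * β + (V.a₃ : ZMod q)) ^ 2 →
    β = (x₄ : ZMod q) ∧ (γ = (y₄ : ZMod q) ∨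
      γ = -(y₄ : ZMod q) - (V.a₁ : ZMod q) * (x₄ : ZMod q) - (V.a₃ : ZMod q)))

/-- Soundness of `twoTorsionOnlyB ∧ halfTOnlyB` in `Ẽ(𝔽_q)`: a point `z` with `4 • z = 0` is `O`,
the reduction `T̃` of `T`, or `±(x₄, y₄)`. [cite: SilvermanAEC2009, III.2.3] -/
theorem eq_of_halfTOnlyB (q : ℕ) [Fact q.Prime] {xT yT x₄ y₄ : ℤ}
    (h1 : twoTorsionOnlyB V q xT yT = true) (h2 : halfTOnlyB V q xT x₄ y₄ = true)
    (h₄ : (V.map (Int.castRingHom (ZMod q))).toAffine.Nonsingular (x₄ : ZMod q) (y₄ : ZMod q))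
    (z : (V.map (Int.castRingHom (ZMod q))).toAffine.Point) (hz : 4 • z = 0) :
    z = 0 ∨ (∃ hns, z = Affine.Point.some (xT : ZMod q) (yT : ZMod q) hns) ∨
      z = Affine.Point.some (x₄ : ZMod q) (y₄ : ZMod q) h₄ ∨
      z = -Affine.Point.some (x₄ : ZMod q) (y₄ : ZMod q) h₄ := by
  classical
  have hz2 : 2 • (2 • z) = 0 := by rw [← mul_nsmul]; exact hz
  rcases eq_zero_or_eq_of_twoTorsionOnlyB V q h1 (2 • z) hz2 with h0 | ⟨hns', hsome⟩
  · rcases eq_zero_or_eq_of_twoTorsionOnlyB V q h1 z h0 with rfl | ⟨hns, rfl⟩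
    · exact Or.inl rfl
    · exact Or.inr (Or.inl ⟨hns, rfl⟩)
  · simp only [halfTOnlyB, decide_eq_true_eq] at h2
    rcases z with _ | ⟨β, γ, hns⟩
    · rw [← Affine.Point.zero_def, nsmul_zero] at hsome
      exact absurd hsome.symm (Affine.Point.some_ne_zero _)
    · have ha₁ : (V.map (Int.castRingHom (ZMod q))).a₁ = (V.a₁ : ZMod q) := by
        simp [WeierstrassCurve.map]
      have ha₂ : (V.map (Int.castRingHom (ZMod q))).a₂ = (V.a₂ : ZMod q) := by
        simp [WeierstrassCurve.map]
      have ha₃ : (V.map (Int.castRingHom (ZMod q))).a₃ = (V.a₃ : ZMod q) := by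
        simp [WeierstrassCurve.map]
      have ha₄ : (V.map (Int.castRingHom (ZMod q))).a₄ = (V.a₄ : ZMod q) := by
        simp [WeierstrassCurve.map]
      have ha₆ : (V.map (Int.castRingHom (ZMod q))).a₆ = (V.a₆ : ZMod q) := by
        simp [WeierstrassCurve.map]
      have heq : γ ^ 2 + (V.a₁ : ZMod q) * β * γ + (V.a₃ : ZMod q) * γ =
          β ^ 3 + (V.a₂ : ZMod q) * β ^ 2 + (V.a₄ : ZMod q) * β + (V.a₆ : ZMod q) := by
        have e := (Affine.equation_iff β γ).mp hns.left
        rwa [ha₁, ha₂, ha₃, ha₄, ha₆] at e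
      by_cases hy : γ = (V.map (Int.castRingHom (ZMod q))).toAffine.negY β γ
      · rw [two_nsmul, Affine.Point.add_self_of_Y_eq hy] at hsome
        exact absurd hsome (Affine.Point.some_ne_zero _).symm
      · rw [two_nsmul, Affine.Point.add_self_of_Y_ne hy, Affine.Point.some.injEq] at hsome
        obtain ⟨hx, -⟩ := hsome
        have hDval : γ - (V.map (Int.castRingHom (ZMod q))).toAffine.negY β γ =
            2 * γ + (V.a₁ : ZMod q) * β + (V.a₃ : ZMod q) := by
          simp only [Affine.negY, ha₁, ha₃]; ring
        have hD' : 2 * γ + (V.a₁ : ZMod q) * β + (V.a₃ : ZMod q) ≠ 0 := by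
          rw [← hDval]; exact sub_ne_zero.mpr hy
        have hLD : (V.map (Int.castRingHom (ZMod q))).toAffine.slope β β γ γ *
            (2 * γ + (V.a₁ : ZMod q) * β + (V.a₃ : ZMod q)) =
            3 * β ^ 2 + 2 * (V.a₂ : ZMod q) * β + (V.a₄ : ZMod q) - (V.a₁ : ZMod q) * γ := by
          rw [Affine.slope_of_Y_ne rfl hy, hDval, ha₁, ha₂, ha₄]; exact div_mul_cancel₀ _ hD'
        have key : (xT : ZMod q) * (2 * γ + (V.a₁ : ZMod q) * β + (V.a₃ : ZMod q)) ^ 2 =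
            (3 * β ^ 2 + 2 * (V.a₂ : ZMod q) * β + (V.a₄ : ZMod q) - (V.a₁ : ZMod q) * γ) ^ 2
              + (V.a₁ : ZMod q) * (3 * β ^ 2 + 2 * (V.a₂ : ZMod q) * β + (V.a₄ : ZMod q)
                  - (V.a₁ : ZMod q) * γ) * (2 * γ + (V.a₁ : ZMod q) * β + (V.a₃ : ZMod q))
              - ((V.a₂ : ZMod q) + 2 * β) * (2 * γ + (V.a₁ : ZMod q) * β + (V.a₃ : ZMod q)) ^ 2 := by
          rw [← hx, ← hLD]
          simp only [Affine.addX, ha₁, ha₂]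
          ring
        obtain ⟨hβ, hγ⟩ := h2 β γ heq hD' key
        subst hβ
        rcases hγ with rfl | rfl
        · exact Or.inr (Or.inr (Or.inl rfl))
        · right; right; right
          rw [Affine.Point.neg_some, Affine.Point.some.injEq]
          exact ⟨rfl, by rw [Affine.negY, ha₁, ha₃]⟩

end HalfT

end Summit.BirchSwinnertonDyer.BirchSwinnertonDyer.Rank2Observatory
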